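import Literature.IUT.HodgeTheaters.ProfiniteCompletionCentralizers
import Literature.GroupTheory.CombinatorialGroupTheory.FreeGroupConjugacySeparable
import Mathlib.Data.ZMod.Basic
import HarnessLib

/-!
# [IUTchI] §2 tool, part 2: centralizers in free groups and the normalizers `N_{F̂}(T̂_g)` of the
# closed procyclic subgroups `T̂_g = closure (η ⟨g⟩)` (the instances of Lemma 2.7 (v) used in print)

Mochizuki, *Inter-universal Teichmüller theory I*, kurims manuscript (May 2020), §2: proof of
Theorem 2.6, p. 57 ("`H_x, H_y ⊆ H_G` the subgroups generated by `x` and `y`; `Ĥ_x, Ĥ_y ⊆ Ĝ` the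
respective closures … by Lemma 2.7, (v), we conclude that `N_Ĝ(H_x) = Ĥ_x`, `N_Ĝ(H_y) = Ĥ_y`") and
proof of Lemma 2.7 (vi), p. 59 ("the closed subgroups `T̂_x, T̂_y ⊆ Ĝ` topologically generated by `x`
and `y` … are normally terminal") [cite: Mochizuki2012, Thm 2.6 p.57] (D-0012 claim key; series status
DISPUTED — the content here is classical group theory and takes no side).

PROOF-ONLY companion of `ProfiniteCompletionCentralizers.lean` (abc-iut-L5-d2):

* `centralizer_eq_zpowers_of_not_isPower` — in a free group the centralizer of an element that is not
  a proper power is the cyclic subgroup it generates (the subgroup generated by two commuting elements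
  is free, by Nielsen–Schreier, and abelian, hence cyclic: abc-iut-L5-t9's
  `FreeOrSurface.isCyclic_of_isFreeGroup_of_comm`); `not_isPower_of_map_eq_ofAdd_one` — an element
  sent to a generator of `ℤ` by some homomorphism is not a proper power (the elements `x` of p. 57 with
  "`H_x ↪ G ↠ G^{ab}` a split injection"); `FreeGroup.centralizer_of_eq_zpowers` — the case of a free
  generator;
* `normalizer_closure_zpowers_subset_centralizer` — for ANY group `F` and `g ∈ F` sent to a generator
  of `ℤ` by some `φ : F → ℤ`: an element of `F̂` normalizing `T̂_g = closure (η ⟨g⟩)` centralizes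
  `η g` (finite quotients only: a conjugate of `g` congruent to `g^u` modulo `N ∩ Ker(φ mod m)`,
  `m = ord(g mod N)`, has `u ≡ 1 (mod m)`);
* `conjugacySeparable_hcs` — the conjugacy-separability input of part 1 (hypothesis `hcs`, membership
  form) DISCHARGED from the tree's `FreeGroup.conjugacySeparable` (Stebe 1970; abc-iut-L5-t14,
  `FreeGroupConjugacySeparable.lean`), so that everything below is UNCONDITIONAL:
  `centralizer_toCompletion_eq_closure_of_isFreeGroup'`, `centralizerCondition` (the shape consumed by
  the Theorem 2.6 assembly), `normalizer_closure_zpowers_eq_of_isFreeGroup` — for `F` free and `g` as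
  above, `N_{F̂}(T̂_g) = C_{F̂}(η g) = T̂_g`, the normal terminality invoked on pp. 57, 59, obtained WITHOUT
  the `l`-cohomological-dimension argument of the printed proof of Lemma 2.7 (v) — and
  `centralizer_eta_basis_le_closure_zpowers` (the shape consumed by the [EtTh] Lem. 2.17 (i) discharge).

Lemma 2.7 (v) itself (an arbitrary closed `T̂` with a `Ẑ`-retraction) is NOT claimed here.
-/

namespace Literature.IUT.HodgeTheaters.ProfiniteCompletion

open CategoryTheory ProfiniteGrp ProfiniteGrp.ProfiniteCompletion Topology Pointwise

universe u

variable {F : Type u} [Group F]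

/-! ### Centralizers in free groups -/

/-- `⟨x⟩ ⊆ C(x)`. [cite: Mochizuki2012, Lem 2.7(iv) p.57] -/
theorem zpowers_le_centralizer_singleton (x : F) :
    Subgroup.zpowers x ≤ Subgroup.centralizer ({x} : Set F) := by
  rw [Subgroup.zpowers_le, Subgroup.mem_centralizer_iff]
  intro h hh
  rw [Set.mem_singleton_iff] at hh
  rw [hh]

/-- **Centralizers in free groups**: if `F` is free and `x ∈ F` is not a proper power, then
`C_F(x) = ⟨x⟩` — the subgroup generated by `x` and any `w ∈ C_F(x)` is free [Nielsen–Schreier] and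
abelian, hence cyclic ([IUTchI] Lem 2.7 (i), (iv), p. 57), generated by a root of `x`, i.e. by `x^{±1}`.
[cite: Mochizuki2012, Lem 2.7(iv) p.57] -/
theorem centralizer_eq_zpowers_of_not_isPower [IsFreeGroup F] {x : F}
    (hx : ∀ (z : F) (n : ℤ), z ^ n = x → n = 1 ∨ n = -1) :
    Subgroup.centralizer ({x} : Set F) = Subgroup.zpowers x := by
  refine le_antisymm ?_ (zpowers_le_centralizer_singleton x)
  intro w hw
  rw [Subgroup.mem_centralizer_iff] at hw
  have hxw : x * w = w * x := hw x (Set.mem_singleton x)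
  -- the subgroup generated by `x` and `w` is free and abelian, hence cyclic
  let H : Subgroup F := Subgroup.closure ({x, w} : Set F)
  have hcomm : ∀ a ∈ ({x, w} : Set F), ∀ b ∈ ({x, w} : Set F), a * b = b * a := by
    intro a ha b hb
    simp only [Set.mem_insert_iff, Set.mem_singleton_iff] at ha hb
    rcases ha with rfl | rfl <;> rcases hb with rfl | rfl
    · rfl
    · exact hxw
    · exact hxw.symm
    · rfl
  have hH : ∀ a b : H, a * b = b * a := by
    haveI := Subgroup.isMulCommutative_closure hcomm
    exact fun a b => IsMulCommutative.is_comm.comm a b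
  haveI hcyc : IsCyclic H := FreeOrSurface.isCyclic_of_isFreeGroup_of_comm H hH
  obtain ⟨z, hz⟩ := IsCyclic.exists_generator (α := H)
  have hxH : x ∈ H := Subgroup.subset_closure (by simp)
  have hwH : w ∈ H := Subgroup.subset_closure (by simp)
  obtain ⟨a, ha⟩ := Subgroup.mem_zpowers_iff.mp (hz ⟨x, hxH⟩)
  obtain ⟨b, hb⟩ := Subgroup.mem_zpowers_iff.mp (hz ⟨w, hwH⟩)
  have ha' : (z : F) ^ a = x := by
    have := congrArg Subtype.val ha
    simpa using this
  have hb' : (z : F) ^ b = w := by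
    have := congrArg Subtype.val hb
    simpa using this
  rcases hx (z : F) a ha' with rfl | rfl
  · rw [zpow_one] at ha'
    rw [← hb', ha']
    exact Subgroup.zpow_mem_zpowers x b
  · have hz' : (z : F) = x⁻¹ := by
      rw [← ha', zpow_neg_one, inv_inv]
    rw [← hb', hz', inv_zpow']
    exact Subgroup.zpow_mem_zpowers x (-b)

/-- An element mapped to a generator of `ℤ` by some homomorphism `φ : F → ℤ` is not a proper power
(if `z ^ n = x` then `n · φ(z) = 1`).  This is the situation "`H_x ↪ G ↠ G^{ab}` is a split injection"
of the proof of Theorem 2.6, p. 57. [cite: Mochizuki2012, Thm 2.6 p.57] -/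
theorem not_isPower_of_map_eq_ofAdd_one {x : F} (φ : F →* Multiplicative ℤ)
    (hφ : φ x = Multiplicative.ofAdd 1) (z : F) (n : ℤ) (hz : z ^ n = x) : n = 1 ∨ n = -1 := by
  have h := congrArg φ hz
  rw [map_zpow, hφ] at h
  have h' : n * Multiplicative.toAdd (φ z) = 1 := by
    have := congrArg Multiplicative.toAdd h
    rw [toAdd_zpow, toAdd_ofAdd, smul_eq_mul] at this
    exact this
  exact Int.isUnit_iff.mp (IsUnit.of_mul_eq_one _ h')

/-- **The centralizer of a free generator**: `C_{F(ι)}(x_i) = ⟨x_i⟩`.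
[cite: Mochizuki2012, Lem 2.7(iv) p.57] -/
theorem FreeGroup.centralizer_of_eq_zpowers {ι : Type u} (i : ι) :
    Subgroup.centralizer ({FreeGroup.of i} : Set (FreeGroup ι)) =
      Subgroup.zpowers (FreeGroup.of i) := by
  classical
  exact centralizer_eq_zpowers_of_not_isPower (not_isPower_of_map_eq_ofAdd_one
    (FreeGroup.lift fun j => if j = i then Multiplicative.ofAdd (1 : ℤ) else 1)
    (by rw [FreeGroup.lift_apply_of, if_pos rfl]))

/-! ### Conjugacy separability discharged: the unconditional centralizer condition -/

/-- **Conjugacy separability of free groups, membership form** — the hypothesis `hcs` of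
`ProfiniteCompletionCentralizers`, DISCHARGED by the tree's `FreeGroup.conjugacySeparable`
([IUTchI] p. 57: "[Stb1], Theorem 1, when `G` is free"). [cite: Mochizuki2012, Thm 2.6 p.57] -/
theorem conjugacySeparable_hcs :
    ∀ (ι : Type u) (u v : FreeGroup ι), ¬ IsConj u v →
      ∃ K : Subgroup (FreeGroup ι), K.Normal ∧ K.FiniteIndex ∧
        ∀ c : FreeGroup ι, (c * u * c⁻¹)⁻¹ * v ∉ K :=
  hcs_of_quotient_form FreeGroup.conjugacySeparable

/-- **The centralizer condition, unconditionally**: for `G ⊆ F` of finite index and free, and `g ∈ G`,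
`C_{F̂}(η g) = closure (η (C_F(g)))`. [cite: Mochizuki2012, Thm 2.6 p.57] -/
theorem centralizer_toCompletion_eq_closure_of_isFreeGroup' (G : Subgroup F) [G.FiniteIndex]
    (hG : IsFreeGroup G) {g : F} (hg : g ∈ G) :
    (Subgroup.centralizer ({toCompletion F g} : Set (profiniteCompletion F)) : Set _) =
      closure (toCompletion F '' (Subgroup.centralizer ({g} : Set F) : Set F)) :=
  centralizer_toCompletion_eq_closure_of_isFreeGroup conjugacySeparable_hcs G hG hg

/-- **The centralizer condition in the shape consumed by the Theorem 2.6 assembly, unconditionally**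
(abc-iut-L5-t9's hypothesis `hCC`, now a theorem): for every group `F`, finite-index subgroup `G` free of
finite rank, `g ∈ G` and `σ ∈ F̂` commuting with `η g`, `σ ∈ closure (η (C_F(g)))`.
[cite: Mochizuki2012, Thm 2.6 p.57] -/
theorem centralizerCondition :
    ∀ (F : Type u) [Group F] (G : Subgroup F) [G.FiniteIndex], IsFreeOfFiniteRank ↥G →
      ∀ g ∈ G, ∀ σ : profiniteCompletion F, σ * toCompletion F g = toCompletion F g * σ →
        σ ∈ closure (toCompletion F '' (Subgroup.centralizer ({g} : Set F) : Set F)) :=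
  fun F _ G _ hG g hg σ hσ => mem_closure_centralizer_of_commute conjugacySeparable_hcs F G hG g hg σ hσ

/-! ### Normalizers of the closed procyclic subgroups `T̂_g = closure (η ⟨g⟩)` -/

/-- For ANY group `F` and any `g ∈ F` mapped to a generator of `ℤ` by some `φ : F → ℤ`, an element of
`F̂` that normalizes `T̂_g := closure (η ⟨g⟩)` CENTRALIZES `η g`: modulo each finite-index normal `N`, a
conjugate `a g a⁻¹` of `g` congruent to a power `g^u` modulo `N ∩ Ker(φ mod m)` (`m` the order of `g`
modulo `N`) satisfies `φ(g) ≡ u·φ(g) (mod m)`, i.e. `u ≡ 1 (mod m)`, i.e. `g^u ≡ g (mod N)`.  This is the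
reduction "`N_{F̂}(T̂_g) = Z_{F̂}(T̂_g)`" of the printed proof of Lemma 2.7 (v), p. 59, made effective at
finite levels. [cite: Mochizuki2012, Lem 2.7(v) p.59] -/
theorem normalizer_closure_zpowers_subset_centralizer (g : F) (φ : F →* Multiplicative ℤ)
    (hφ : φ g = Multiplicative.ofAdd 1) :
    (Subgroup.normalizer (closure (toCompletion F '' (Subgroup.zpowers g : Set F))) :
        Set (profiniteCompletion F)) ⊆
      Subgroup.centralizer ({toCompletion F g} : Set (profiniteCompletion F)) := by
  intro γ hγ
  rw [SetLike.mem_coe, Subgroup.mem_centralizer_iff]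
  -- it suffices to show `γ · η g · γ⁻¹ = η g`
  suffices h : γ * toCompletion F g * γ⁻¹ = toCompletion F g by
    intro y hy
    rw [Set.mem_singleton_iff] at hy
    subst hy
    calc toCompletion F g * γ = γ * toCompletion F g * γ⁻¹ * γ := by rw [h]
      _ = γ * toCompletion F g := by rw [inv_mul_cancel_right]
  have hmemT : γ * toCompletion F g * γ⁻¹ ∈
      closure (toCompletion F '' (Subgroup.zpowers g : Set F)) := by
    rw [SetLike.mem_coe, Subgroup.mem_set_normalizer_iff] at hγ
    exact (hγ _).mp (subset_closure ⟨g, Subgroup.mem_zpowers g, rfl⟩)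
  apply limit_ext
  intro N
  -- the order `m ≥ 1` of `g` modulo `N` and the level `N₁ = N ∩ Ker(φ mod m)`
  set m : ℕ := orderOf (QuotientGroup.mk g : F ⧸ N.toSubgroup) with hm
  have hm0 : m ≠ 0 := (orderOf_pos (QuotientGroup.mk g : F ⧸ N.toSubgroup)).ne'
  haveI : NeZero m := ⟨hm0⟩
  let ψ : F →* Multiplicative (ZMod m) :=
    (AddMonoidHom.toMultiplicative (Int.castAddHom (ZMod m))).comp φ
  have hψg : ψ g = Multiplicative.ofAdd (1 : ZMod m) := by
    simp [ψ, hφ]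
  let N₁ : FiniteIndexNormalSubgroup F := N ⊓ FiniteIndexNormalSubgroup.ofSubgroup ψ.ker
  have hN₁N : N₁ ≤ N := inf_le_left
  have hN₁ker : N₁.toSubgroup ≤ ψ.ker := fun y hy => (inf_le_right : N₁ ≤ _) hy
  -- a representative `a` of `γ` modulo `N₁`; the `N₁`-component of the conjugate is `a g a⁻¹ · N₁`
  obtain ⟨a, ha⟩ : ∃ a : F, γ.val N₁ = (QuotientGroup.mk a : F ⧸ N₁.toSubgroup) := by
    obtain ⟨a, ha⟩ := QuotientGroup.mk_surjective (γ.val N₁)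
    exact ⟨a, ha.symm⟩
  let π : profiniteCompletion F →* F ⧸ N₁.toSubgroup :=
    MonoidHom.mk' (fun x => (x.val N₁ : F ⧸ N₁.toSubgroup)) fun _ _ => rfl
  have hπγ : π γ = QuotientGroup.mk a := ha
  have hconj : π (γ * toCompletion F g * γ⁻¹) = QuotientGroup.mk (a * g * a⁻¹) := by
    rw [map_mul, map_mul, map_inv, hπγ]
    rfl
  -- … and it lies in the image of `⟨g⟩`: it is `g^u · N₁` for some `u ∈ ℤ`
  obtain ⟨y, hy, hyval⟩ := val_mem_map_of_mem_closure hmemT N₁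
  obtain ⟨u, rfl⟩ := Subgroup.mem_zpowers_iff.mp hy
  have hyval' : π (γ * toCompletion F g * γ⁻¹) = QuotientGroup.mk (g ^ u) := hyval.symm
  have hmod : (a * g * a⁻¹)⁻¹ * g ^ u ∈ N₁.toSubgroup := by
    rw [← QuotientGroup.eq, ← hconj, hyval']
  -- apply `ψ = φ mod m` (which kills `N₁` and is valued in an abelian group): `u ≡ 1 (mod m)`
  have hψ : ψ (a * g * a⁻¹) = ψ (g ^ u) := by
    rw [← inv_mul_eq_one, ← map_inv, ← map_mul]
    exact hN₁ker hmod
  have hψ' : ψ g = ψ g ^ u := by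
    rw [← map_zpow, ← hψ, map_mul, map_mul, map_inv, mul_inv_cancel_comm]
  have hu : ((u : ℤ) : ZMod m) = 1 := by
    rw [hψg] at hψ'
    have := congrArg Multiplicative.toAdd hψ'
    rw [toAdd_zpow, toAdd_ofAdd, zsmul_eq_mul, mul_one] at this
    exact this.symm
  have humod : u ≡ 1 [ZMOD (m : ℤ)] := by
    rw [← ZMod.intCast_eq_intCast_iff, hu, Int.cast_one]
  -- conclude at level `N`: `g^u ≡ g (mod N)` since `m` is the order of `g` modulo `N`
  have hN : (γ * toCompletion F g * γ⁻¹).val N = (QuotientGroup.mk (g ^ u) : F ⧸ N.toSubgroup) :=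
    val_mk_eq_of_le _ hN₁N (g ^ u) hyval.symm
  rw [hN]
  change (QuotientGroup.mk (g ^ u) : F ⧸ N.toSubgroup) = QuotientGroup.mk g
  rw [QuotientGroup.mk_zpow, ← zpow_one (QuotientGroup.mk g : F ⧸ N.toSubgroup), ← zpow_mul, one_mul,
    zpow_eq_zpow_iff_modEq, ← hm]
  exact humod

/-- `T̂_g = closure (η ⟨g⟩)` is contained in its own normalizer (it is a subgroup: the topological
closure of the image subgroup `η(⟨g⟩)`). [cite: Mochizuki2012, Lem 2.7(v) p.59] -/
theorem closure_zpowers_subset_normalizer (g : F) :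
    closure (toCompletion F '' (Subgroup.zpowers g : Set F)) ⊆
      (Subgroup.normalizer (closure (toCompletion F '' (Subgroup.zpowers g : Set F))) :
        Set (profiniteCompletion F)) := by
  have hT : closure (toCompletion F '' (Subgroup.zpowers g : Set F)) =
      ((((Subgroup.zpowers g).map (toCompletion F)).topologicalClosure : Subgroup (profiniteCompletion F)) :
        Set (profiniteCompletion F)) := by
    rw [Subgroup.topologicalClosure_coe, Subgroup.coe_map]
  rw [hT]
  exact Subgroup.le_normalizer

/-- **The normal terminality used on pp. 57 and 59** (instances of Lemma 2.7 (v)).  Let `F` be a free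
group, `g ∈ F` an element mapped to a generator of `ℤ` by some homomorphism `φ : F → ℤ`, and
`T̂_g := closure (η ⟨g⟩) ⊆ F̂`.  Then (unconditionally, conjugacy separability being in the tree)
`N_{F̂}(T̂_g) = T̂_g` and `C_{F̂}(η g) = T̂_g`.
[cite: Mochizuki2012, Lem 2.7(v) p.59] -/
theorem normalizer_closure_zpowers_eq_of_isFreeGroup [IsFreeGroup F]
    (g : F) (φ : F →* Multiplicative ℤ) (hφ : φ g = Multiplicative.ofAdd 1) :
    (Subgroup.normalizer (closure (toCompletion F '' (Subgroup.zpowers g : Set F))) :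
        Set (profiniteCompletion F)) = closure (toCompletion F '' (Subgroup.zpowers g : Set F)) ∧
    (Subgroup.centralizer ({toCompletion F g} : Set (profiniteCompletion F)) : Set _) =
        closure (toCompletion F '' (Subgroup.zpowers g : Set F)) := by
  -- the centralizer condition for `g ∈ F = ⊤`, and `C_F(g) = ⟨g⟩`
  have hC : (Subgroup.centralizer ({toCompletion F g} : Set (profiniteCompletion F)) : Set _) =
      closure (toCompletion F '' (Subgroup.zpowers g : Set F)) := by
    have h := centralizer_toCompletion_eq_closure_of_isFreeGroup' (⊤ : Subgroup F)
      (IsFreeGroup.ofMulEquiv (Subgroup.topEquiv (G := F)).symm) (Subgroup.mem_top g)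
    rwa [centralizer_eq_zpowers_of_not_isPower (not_isPower_of_map_eq_ofAdd_one φ hφ)] at h
  exact ⟨Set.Subset.antisymm ((normalizer_closure_zpowers_subset_centralizer g φ hφ).trans hC.subset)
    (closure_zpowers_subset_normalizer g), hC⟩

/-- **The centralizer of a free generator in `F̂` is procyclic on it** — the shape consumed by the
[EtTh] Lemma 2.17 (i) discharge (abc-iut-L2-d3's hypothesis `hCent` VERBATIM, its printed input
"[CombGC] Prop. 1.2 (ii)"), unconditionally: for a group `J` with a free basis `β : FreeGroupBasis κ J`
and `i : κ`,
`C_{Ĵ}(η (β i)) ⊆ closure ⟨η (β i)⟩`. [cite: Mochizuki2012, Thm 2.6 p.57] -/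
theorem centralizer_eta_basis_le_closure_zpowers
    (J : Type u) [Group J] (κ : Type u) (β : FreeGroupBasis κ J) (i : κ) :
    let η : J →* ProfiniteGrp.ProfiniteCompletion.completion (GrpCat.of J) :=
      (ProfiniteGrp.ProfiniteCompletion.eta (GrpCat.of J)).hom
    Subgroup.centralizer {η (β i)} ≤ (Subgroup.zpowers (η (β i))).topologicalClosure := by
  classical
  intro η σ hσ
  haveI : IsFreeGroup J := β.isFreeGroup
  -- the coordinate homomorphism `β i ↦ 1`
  let φ : J →* Multiplicative ℤ :=
    (FreeGroup.lift fun j => if j = i then Multiplicative.ofAdd (1 : ℤ) else 1).comp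
      β.repr.toMonoidHom
  have hφ : φ (β i) = Multiplicative.ofAdd 1 := by
    simp only [φ, MonoidHom.coe_comp, Function.comp_apply, MulEquiv.coe_toMonoidHom,
      FreeGroupBasis.repr_apply_coe, FreeGroup.lift_apply_of, if_true]
  have hC := (normalizer_closure_zpowers_eq_of_isFreeGroup (β i) φ hφ).2
  have hσ' : σ ∈ closure (toCompletion J '' (Subgroup.zpowers (β i) : Set J)) := by
    rw [← hC]; exact hσ
  rwa [← Subgroup.coe_map, ← Subgroup.topologicalClosure_coe, MonoidHom.map_zpowers] at hσ'

end Literature.IUT.HodgeTheaters.ProfiniteCompletion
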